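import Summits.AtomisticToContinuum.HydrodynamicLimit.Theorems.RelayRaceLocalityNearConstantShortTimeHLMomentPackage
import Summits.AtomisticToContinuum.HydrodynamicLimit.Theorems.RelayRaceLocalityNearConstantShortTimeHLGaussianTail
import Summits.AtomisticToContinuum.HydrodynamicLimit.Theorems.RelayRaceLocalityNearConstantShortTimeHLKineticMoments
import Summits.AtomisticToContinuum.HydrodynamicLimit.Theorems.RelayRaceLocalityNearConstantShortTimeHLGeneralGibbs
import Summits.AtomisticToContinuum.HydrodynamicLimit.Theorems.RelayRaceLocalityNearConstantShortTimeHLLogProfileObsBounds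
import Summits.AtomisticToContinuum.HydrodynamicLimit.Theorems.RelayRaceLocalityNearConstantShortTimeHLFluctuationTools
import Summits.AtomisticToContinuum.HydrodynamicLimit.Theorems.RelayRaceLocalityNearConstantShortTimeHLDynLimits
import HarnessLib

/-!
# Crux `NearConstantShortTimeHL` (stmt-AtomisticToContinuum-12502), line `small-tilt-domination` (skeleton v23, lead c9) —
# helper `moment_packageE` of the stub `stub_dynamicPE`: the kinetic-moment bookkeeping from SUPER-EXPONENTIAL velocity tails

Support file (`--supports stmt-AtomisticToContinuum-12502`). Skeleton v23 weakens the velocity-tail input along the true law of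
the dynamic theorem from Gaussian tails in mean (`DynamicTheoremPQ`, input `E[n⁻¹ Σᵢ exp(a‖vᵢ(s)‖²)] ≤ A` for ONE `a > 0`) to
super-exponential tails in mean (`DynamicTheoremPE`, `…ExpTailDefs`: for EVERY `b > 0` some `A_b ≥ 0` with
`E_{P N}[n⁻¹ Σᵢ exp(b‖vᵢ(s)‖)] ≤ A_b` eventually in `N`, uniformly in `s ∈ [0, t]`). This file is the twin of the landed
`moment_package` (`…MomentPackage`) in that currency:

* STATICS (every `N`): the kinetic package (`K = n⁻¹ Σᵢ ‖vᵢ‖²/2` and `K²` integrable, `E[K] ≤ CK`, the truncation bound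
  `∫_S (1 + K) ≤ (1 + M') P(S) + CK/M'`) does not see the tail input at all — it is the statics clause of `moment_package`,
  invoked on the empty time window `[0, −1]` (where its Gaussian hypothesis is vacuous);
* CUBIC MOMENTS along the flow: `x³ ≤ (6/b³) e^{bx}` (`x ≥ 0`, `b > 0`; the cubic Taylor term of the exponential,
  `Real.pow_div_factorial_le_exp`), so the first exponential moment prices `E[n⁻¹ Σᵢ ‖vᵢ(r)‖³] ≤ 6 A₁`;
* CUBIC TAILS along the flow, for EVERY rate `b > 0`: pointwise `x³ 𝟙{x > L} ≤ (6/b³) e^{−bL} e^{2bx}` (no constraint on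
  the level `L`), so `E[cubicTail L (Φ_r z)] ≤ (6/b³) e^{−bL} A_{2b}` — the tail beats ANY exponential `e^{CL}` once `b > C`,
  which is what the Grönwall assembly needs (the truncated currents cost a factor `1 + L` in the rate);
* the level lemma `dyn_exists_levelE` (twin of `dyn_exists_level`, `…DynLimits`): `K e^{−(c+1)L} e^{c(1+L)} = K eᶜ e^{−L} ≤ ε`
  for `L` large.

Helpers are prefixed `xe_`. No definitions, no named facts.

References: H.-T. Yau, Lett. Math. Phys. 22 (1991) §2 (relative-entropy method, large-velocity cutoff); B. Nachtergaele –
H.-T. Yau, Comm. Math. Phys. 243 (2003) §7.2 (the `e^{δ⁻¹MT₀}` cut-off structure: super-exponential tails suffice).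
-/

noncomputable section

namespace Summit.AtomisticToContinuum.HydrodynamicLimit.Theorems.NearConstantShortTimeHL

open scoped BigOperators ENNReal
open MeasureTheory Filter Set Topology
open Literature.MathematicalPhysics.KineticTheory Literature.Analysis.FluidPDE Literature.Analysis.FunctionSpaces

/-! ## The level lemma -/

/-- **Choice of the cubic-tail level against an exponential tail.** For `K ≥ 0`, `ε > 0` and any `c, Lmin` there is
`L ≥ max(Lmin, 1)` with `K e^{−(c+1)L} e^{c(1+L)} ≤ ε` (the product is `K eᶜ e^{−L}`, and `e^{−L} → 0`). Twin of
`dyn_exists_level` for the rate `b = c + 1` chosen after the amplification constant `c`. [folklore] -/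
theorem dyn_exists_levelE (c K Lmin ε : ℝ) (hK : 0 ≤ K) (hε : 0 < ε) :
    ∃ L : ℝ, Lmin ≤ L ∧ 1 ≤ L ∧ K * Real.exp (-((c + 1) * L)) * Real.exp (c * (1 + L)) ≤ ε := by
  set M : ℝ := K * Real.exp c + 1 with hM
  have hM0 : 0 < M := by positivity
  have hev : ∀ᶠ L : ℝ in atTop, Real.exp (-L) < ε / M :=
    Real.tendsto_exp_neg_atTop_nhds_zero.eventually (gt_mem_nhds (by positivity))
  obtain ⟨L, h1, hLmin, hL1⟩ := (hev.and ((eventually_ge_atTop Lmin).and (eventually_ge_atTop (1 : ℝ)))).exists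
  refine ⟨L, hLmin, hL1, ?_⟩
  have e : Real.exp (-((c + 1) * L)) * Real.exp (c * (1 + L)) = Real.exp c * Real.exp (-L) := by
    rw [← Real.exp_add, ← Real.exp_add]
    congr 1
    ring
  calc K * Real.exp (-((c + 1) * L)) * Real.exp (c * (1 + L))
      = K * Real.exp c * Real.exp (-L) := by rw [mul_assoc, e, ← mul_assoc]
    _ ≤ M * Real.exp (-L) := mul_le_mul_of_nonneg_right (by linarith) (Real.exp_pos _).le
    _ ≤ M * (ε / M) := mul_le_mul_of_nonneg_left h1.le hM0.le
    _ = ε := mul_div_cancel₀ ε hM0.ne'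

/-! ## Pointwise: cubes and cubic tails against exponential moments -/

/-- **Every cube is dominated by an exponential moment**: `x³ ≤ (6/b³) e^{bx}` for `b > 0`, `x ≥ 0` (the cubic Taylor
term `(bx)³/3! ≤ e^{bx}`). [folklore] -/
theorem xe_cube_le_exp {b : ℝ} (hb : 0 < b) {x : ℝ} (hx : 0 ≤ x) : x ^ 3 ≤ 6 / b ^ 3 * Real.exp (b * x) := by
  have h := Real.pow_div_factorial_le_exp (x := b * x) (by positivity) 3
  rw [show ((Nat.factorial 3 : ℕ) : ℝ) = 6 by norm_num [Nat.factorial], mul_pow,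
    div_le_iff₀ (by norm_num : (0 : ℝ) < 6)] at h
  rw [div_mul_eq_mul_div, le_div_iff₀ (by positivity : (0 : ℝ) < b ^ 3)]
  linarith [h]

/-- The one-particle cubic tail is dominated by the doubled exponential moment with an exponentially small factor:
`‖v‖³ 𝟙{‖v‖ > L} ≤ (6/b³) e^{−bL} e^{2b‖v‖}` for `b > 0` and ANY level `L` (past `L`, `e^{b‖v‖} ≤ e^{−bL} e^{2b‖v‖}`).
[folklore] -/
theorem xe_indicator_cube_le {b : ℝ} (hb : 0 < b) (L : ℝ) (v : V3) :
    Set.indicator {v : V3 | L < ‖v‖} (fun v => ‖v‖ ^ 3) v ≤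
      6 / b ^ 3 * Real.exp (-(b * L)) * Real.exp (2 * b * ‖v‖) := by
  by_cases hv : L < ‖v‖
  · rw [Set.indicator_of_mem (show v ∈ {v : V3 | L < ‖v‖} from hv)]
    have hbL : b * L ≤ b * ‖v‖ := mul_le_mul_of_nonneg_left hv.le hb.le
    calc ‖v‖ ^ 3 ≤ 6 / b ^ 3 * Real.exp (b * ‖v‖) := xe_cube_le_exp hb (norm_nonneg v)
      _ ≤ 6 / b ^ 3 * (Real.exp (-(b * L)) * Real.exp (2 * b * ‖v‖)) := by
          refine mul_le_mul_of_nonneg_left ?_ (by positivity)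
          rw [← Real.exp_add]
          exact Real.exp_le_exp.2 (by linarith)
      _ = 6 / b ^ 3 * Real.exp (-(b * L)) * Real.exp (2 * b * ‖v‖) := by ring
  · rw [Set.indicator_of_notMem (show v ∉ {v : V3 | L < ‖v‖} from hv)]
    positivity

/-- **Exponential domination of the cubic tail** (pointwise): for `b > 0` and any level `L`,
`n⁻¹ Σᵢ ‖vᵢ‖³ 𝟙{‖vᵢ‖ > L} ≤ (6/b³) e^{−bL} · n⁻¹ Σᵢ exp(2b ‖vᵢ‖)` — sum `xe_indicator_cube_le` over the particles.
[folklore] -/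
theorem cubicTail_le_exp {n : ℕ} {b : ℝ} (hb : 0 < b) (L : ℝ) (w : Config n (Fin 3) T3) :
    cubicTail L w ≤ 6 / b ^ 3 * Real.exp (-(b * L)) * ((n : ℝ)⁻¹ * ∑ i, Real.exp (2 * b * ‖(w i).2‖)) := by
  calc cubicTail L w
        = (n : ℝ)⁻¹ * ∑ i, Set.indicator {v : V3 | L < ‖v‖} (fun v => ‖v‖ ^ 3) (w i).2 := rfl
    _ ≤ (n : ℝ)⁻¹ * ∑ i, 6 / b ^ 3 * Real.exp (-(b * L)) * Real.exp (2 * b * ‖(w i).2‖) := by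
        gcongr with i _
        exact xe_indicator_cube_le hb L (w i).2
    _ = 6 / b ^ 3 * Real.exp (-(b * L)) * ((n : ℝ)⁻¹ * ∑ i, Real.exp (2 * b * ‖(w i).2‖)) := by
        rw [← Finset.mul_sum]
        ring

/-! ## Integration along the flow against an exponential velocity moment -/

/-- The exponential velocity moment `z ↦ n⁻¹ Σᵢ exp(b ‖vᵢ(s)‖)` along the flow is measurable. [folklore] -/
theorem xe_measurable_expMoment_flow {ε : ℝ} {n : ℕ} (Φ : HardSphereFlow (Torus.geometry (Fin 3)) ε n) (b s : ℝ) :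
    Measurable fun z : Config n (Fin 3) T3 => (n : ℝ)⁻¹ * ∑ i : Fin n, Real.exp (b * ‖((Φ.flow s z) i).2‖) := by
  refine Measurable.const_mul (Finset.measurable_sum _ fun i _ => ?_) _
  exact Real.measurable_exp.comp (measurable_const.mul (xv_measurable_vel_flow Φ s i).norm)

/-- **Domination bookkeeping.** If `0 ≤ f ≤ C g` pointwise with `f, g` measurable, `g ≥ 0`, `C, A ≥ 0` and
`∫⁻ ofReal g dP ≤ ofReal A`, then `f` is `P`-integrable and `∫ f dP ≤ C A`. [folklore] -/
theorem xe_integral_le_of_dominated {α : Type*} [MeasurableSpace α] (P : Measure α) {f g : α → ℝ} {C A : ℝ}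
    (hfm : Measurable f) (hgm : Measurable g) (hf0 : ∀ z, 0 ≤ f z) (hg0 : ∀ z, 0 ≤ g z) (hC : 0 ≤ C) (hA0 : 0 ≤ A)
    (hdom : ∀ z, f z ≤ C * g z) (hA : ∫⁻ z, ENNReal.ofReal (g z) ∂P ≤ ENNReal.ofReal A) :
    Integrable f P ∧ ∫ z, f z ∂P ≤ C * A := by
  have hgi : Integrable g P :=
    (lintegral_ofReal_ne_top_iff_integrable hgm.aestronglyMeasurable (ae_of_all _ hg0)).mp
      (ne_top_of_le_ne_top ENNReal.ofReal_ne_top hA)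
  have hgA : ∫ z, g z ∂P ≤ A := by
    rw [integral_eq_lintegral_of_nonneg_ae (ae_of_all _ hg0) hgm.aestronglyMeasurable]
    exact ENNReal.toReal_le_of_le_ofReal hA0 hA
  have hfi : Integrable f P := by
    refine Integrable.mono' (hgi.const_mul C) hfm.aestronglyMeasurable (ae_of_all _ fun z => ?_)
    rw [Real.norm_eq_abs, abs_of_nonneg (hf0 z)]
    exact hdom z
  refine ⟨hfi, ?_⟩
  calc ∫ z, f z ∂P ≤ ∫ z, C * g z ∂P := integral_mono hfi (hgi.const_mul _) hdom
    _ = C * ∫ z, g z ∂P := integral_const_mul _ _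
    _ ≤ C * A := mul_le_mul_of_nonneg_left hgA hC

-- adapted from `xm_integral_cubic_flow_le` (Gaussian version, `…MomentPackage`)
/-- **The cubic velocity moment along the true law is priced by an exponential velocity moment.** For a hard-sphere
flow `Φ`, a law `P`, `b > 0`, `A ≥ 0` and a time `s` with `∫⁻ ofReal (n⁻¹ Σᵢ exp(b ‖vᵢ(s)‖)) dP ≤ ofReal A`:
`z ↦ n⁻¹ Σᵢ ‖vᵢ(s)‖³` is `P`-integrable and `∫ n⁻¹ Σᵢ ‖vᵢ(s)‖³ dP ≤ (6/b³) A` (pointwise `xe_cube_le_exp`).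
[cite: Yau1991, §2] -/
theorem xe_integral_cubic_flow_le {ε : ℝ} {n : ℕ} (Φ : HardSphereFlow (Torus.geometry (Fin 3)) ε n)
    (P : Measure (Config n (Fin 3) T3)) {b A : ℝ} (hb : 0 < b) (hA0 : 0 ≤ A) (s : ℝ)
    (hA : ∫⁻ z, ENNReal.ofReal ((n : ℝ)⁻¹ * ∑ i : Fin n, Real.exp (b * ‖((Φ.flow s z) i).2‖)) ∂P ≤
      ENNReal.ofReal A) :
    Integrable (fun z => (n : ℝ)⁻¹ * ∑ i, ‖((Φ.flow s z) i).2‖ ^ 3) P ∧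
      ∫ z, (n : ℝ)⁻¹ * ∑ i, ‖((Φ.flow s z) i).2‖ ^ 3 ∂P ≤ 6 / b ^ 3 * A := by
  refine xe_integral_le_of_dominated P (f := fun z => (n : ℝ)⁻¹ * ∑ i, ‖((Φ.flow s z) i).2‖ ^ 3)
    (g := fun z => (n : ℝ)⁻¹ * ∑ i : Fin n, Real.exp (b * ‖((Φ.flow s z) i).2‖))
    (Measurable.const_mul (Finset.measurable_sum _ fun i _ => (xv_measurable_vel_flow Φ s i).norm.pow_const 3) _)
    (xe_measurable_expMoment_flow Φ b s)
    (fun z => mul_nonneg (inv_nonneg.mpr (Nat.cast_nonneg n)) (Finset.sum_nonneg fun i _ => by positivity))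
    (fun z => mul_nonneg (inv_nonneg.mpr (Nat.cast_nonneg n)) (Finset.sum_nonneg fun i _ => (Real.exp_pos _).le))
    (by positivity) hA0 (fun z => ?_) hA
  calc (n : ℝ)⁻¹ * ∑ i, ‖((Φ.flow s z) i).2‖ ^ 3
      ≤ (n : ℝ)⁻¹ * ∑ i, 6 / b ^ 3 * Real.exp (b * ‖((Φ.flow s z) i).2‖) := by
        gcongr with i _
        exact xe_cube_le_exp hb (norm_nonneg _)
    _ = 6 / b ^ 3 * ((n : ℝ)⁻¹ * ∑ i : Fin n, Real.exp (b * ‖((Φ.flow s z) i).2‖)) := by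
        rw [← Finset.mul_sum]
        ring

-- adapted from `integral_cubicTail_flow_le` (Gaussian version, `…GaussianTail`)
/-- **The cubic tail along the true law is priced by the doubled exponential velocity moment.** For a hard-sphere flow
`Φ`, a law `P`, `b > 0`, `A ≥ 0`, any level `L` and a time `s` with `∫⁻ ofReal (n⁻¹ Σᵢ exp(2b ‖vᵢ(s)‖)) dP ≤ ofReal A`:
`z ↦ cubicTail L (Φ_s z)` is `P`-integrable and `∫ cubicTail L (Φ_s z) dP ≤ (6/b³) e^{−bL} A` (pointwise
`cubicTail_le_exp`). [cite: Yau1991, §2] -/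
theorem xe_integral_cubicTail_flow_le {ε : ℝ} {n : ℕ} (Φ : HardSphereFlow (Torus.geometry (Fin 3)) ε n)
    (P : Measure (Config n (Fin 3) T3)) {b A : ℝ} (hb : 0 < b) (hA0 : 0 ≤ A) (L s : ℝ)
    (hA : ∫⁻ z, ENNReal.ofReal ((n : ℝ)⁻¹ * ∑ i : Fin n, Real.exp (2 * b * ‖((Φ.flow s z) i).2‖)) ∂P ≤
      ENNReal.ofReal A) :
    Integrable (fun z => cubicTail L (Φ.flow s z)) P ∧
      ∫ z, cubicTail L (Φ.flow s z) ∂P ≤ 6 / b ^ 3 * Real.exp (-(b * L)) * A :=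
  xe_integral_le_of_dominated P (xv_measurable_cubicTail_flow Φ L s) (xe_measurable_expMoment_flow Φ (2 * b) s)
    (fun z => xv_cubicTail_nonneg L _)
    (fun z => mul_nonneg (inv_nonneg.mpr (Nat.cast_nonneg n)) (Finset.sum_nonneg fun i _ => (Real.exp_pos _).le))
    (by positivity) hA0 (fun z => cubicTail_le_exp hb L (Φ.flow s z)) hA

/-! ## Registered helper `moment_packageE` -/

/-- **`moment_packageE`: the kinetic-moment bookkeeping of the dynamic theorem at fixed data from super-exponential
velocity tails.** For a classical hard-sphere Euler solution on `[0, T)`, `T > 0`, the canonical local Gibbs laws `P N`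
matched to its data at time `0` (activity `ρ₀ e^{g_σ(ρ₀)}`, drift `u(0)`, temperature `θ(0)`; probability measures) and ALL
exponential velocity moments in mean along the flow, `∀ b > 0 ∃ A ≥ 0, E_{P N}[n⁻¹ Σᵢ exp(b ‖vᵢ(s)‖)] ≤ A` on `[0, t]`
eventually in `N`: there are `CK, C3 ≥ 0` with (i) for every `N`, `K = n⁻¹ Σᵢ ‖vᵢ‖²/2` and `K²` integrable, `E[K] ≤ CK`, and
`∫_S (1 + K) ≤ (1 + M') P(S) + CK/M'` for measurable `S`, `M' > 0` (the statics clause of `moment_package`); (ii) eventually in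
`N`, for `r ∈ [0, t]`, `E[n⁻¹ Σᵢ ‖vᵢ(r)‖³] ≤ C3` (`xe_integral_cubic_flow_le` at `b = 1`); (iii) for every rate `b > 0` a bound
`A ≥ 0` such that for every level `L`, eventually `E[cubicTail L (Φ_r z)] ≤ (6/b³) e^{−bL} A` on `[0, t]`
(`xe_integral_cubicTail_flow_le` against the `2b`-moment). [cite: Yau1991, §2] -/
theorem moment_packageE : ∀ {σ T : ℝ} {ρ θ : ℝ → T3 → ℝ} {u : ℝ → T3 → V3}, IsHardSphereEulerSolution σ T ρ u θ → 0 < T → ∀ {ε : ℕ → ℝ} {n : ℕ → ℕ} (Φ : (N : ℕ) → HardSphereFlow (Torus.geometry (Fin 3)) (ε N) (n N)) (P : (N : ℕ) → Measure (Config (n N) (Fin 3) T3)), (∀ N, P N = particleLaw (Φ N) (canonicalDensity (Torus.geometry (Fin 3)) (ε N) (n N) (localGibbsProfile (fun x => ρ 0 x * Real.exp (gChem σ (ρ 0 x))) (u 0) (θ 0)))) → (∀ N, IsProbabilityMeasure (P N)) → ∀ {t : ℝ}, (∀ b : ℝ, 0 < b → ∃ A : ℝ, 0 ≤ A ∧ ∀ᶠ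 N : ℕ in atTop, ∀ s ∈ Set.Icc 0 t, ∫⁻ z, ENNReal.ofReal ((n N : ℝ)⁻¹ * ∑ i : Fin (n N), Real.exp (b * ‖((Φ N).flow s z i).2‖)) ∂(P N) ≤ ENNReal.ofReal A) → ∃ CK : ℝ, 0 ≤ CK ∧ ∃ C3 : ℝ, 0 ≤ C3 ∧ (∀ N, Integrable (fun z => kineticPP z) (P N) ∧ Integrable (fun z => kineticPP z ^ 2) (P N) ∧ ∫ z, kineticPP z ∂(P N) ≤ CK ∧ ∀ (S : Set (Config (n N) (Fin 3) T3)), MeasurableSet S → ∀ M' : ℝ, 0 < M' → ∫ z in S, (1 + kineticPP z) ∂(P N) ≤ (1 + M') * (P N S).toReal + CK / M') ∧ (∀ᶠ N : ℕ in atTop, ∀ r ∈ Set.Icc 0 t, Integrable (fun z => (n N : ℝ)⁻¹ * ∑ i, ‖(((Φ N).flow r z) i).2‖ ^ 3) (P N) ∧ ∫ z, (n N : ℝ)⁻¹ * ∑ i, ‖(((Φ N).flow r z) i).2‖ ^ 3 ∂(P N) ≤ C3) ∧ ∀ b : ℝ, 0 < b → ∃ A : ℝ, 0 ≤ A ∧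 ∀ L : ℝ, ∀ᶠ N : ℕ in atTop, ∀ r ∈ Set.Icc 0 t, Integrable (fun z => cubicTail L ((Φ N).flow r z)) (P N) ∧ ∫ z, cubicTail L ((Φ N).flow r z) ∂(P N) ≤ 6 / b ^ 3 * Real.exp (-(b * L)) * A := by
  intro σ T ρ θ u hE hT ε n Φ P hP hprob t hexpm
  -- (i) statics: the kinetic package does not see the tail input — take it from `moment_package` on the empty time
  -- window `[0, -1]`, where its Gaussian hypothesis is vacuous
  have hvac : ∀ᶠ N : ℕ in atTop, ∀ s ∈ Set.Icc (0 : ℝ) (-1), ∫⁻ z, ENNReal.ofReal ((n N : ℝ)⁻¹ *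
      ∑ i : Fin (n N), Real.exp (1 * ‖((Φ N).flow s z i).2‖ ^ 2)) ∂(P N) ≤ ENNReal.ofReal 0 :=
    Filter.Eventually.of_forall fun N s hs => by exfalso; linarith [hs.1, hs.2]
  obtain ⟨CK, hCK, -, -, hmomN, -, -⟩ := moment_package hE hT Φ P hP hprob one_pos le_rfl hvac
  -- (ii) cubic moments from the first exponential moment
  obtain ⟨A1, hA1, hexp1⟩ := hexpm 1 one_pos
  refine ⟨CK, hCK, 6 / 1 ^ 3 * A1, by positivity, hmomN, ?_, fun b hb => ?_⟩
  · filter_upwards [hexp1] with N hN r hr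
    exact xe_integral_cubic_flow_le (Φ N) (P N) one_pos hA1 r (hN r hr)
  -- (iii) cubic tails at rate `b` from the `2b`-moment
  · obtain ⟨A, hA, hexpb⟩ := hexpm (2 * b) (by positivity)
    refine ⟨A, hA, fun L => ?_⟩
    filter_upwards [hexpb] with N hN r hr
    exact xe_integral_cubicTail_flow_le (Φ N) (P N) hb hA L r (hN r hr)

end Summit.AtomisticToContinuum.HydrodynamicLimit.Theorems.NearConstantShortTimeHL

end
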